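import Summits.HodgeConjecture.HodgeConjecture.Theorems.R90S6SatakeGraphPartnerHom    -- ★ W4 (heir g0): `satakeGraphPartnerAlgHom`, `eq_satakeGraphPartner_of_graph`, `graph_satakeGraphPartnerAlgHom`
import Summits.HodgeConjecture.HodgeConjecture.Theorems.R90S6MacdonaldRankOne        -- ★ W8-g (p09): N = 3 recursion, `torusGen_eq_basic`, `doubleCosetOperator_torusGen_mul_self`, eigen forms
import Summits.HodgeConjecture.HodgeConjecture.Theorems.R90S6MacdonaldRankOneU2      -- ★ W8-g′ (this seat): N = 2 recursion, `eq_basic_two`, `doubleCosetOperator_mul_self_two`, eigen forms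
import Summits.HodgeConjecture.HodgeConjecture.Theorems.K2LiuRankOneHeckeCellsTwo    -- ★ `rev_vecOne` (the exponent vector `(1, −1)` is `rev`-antisymmetric) — reused, not restated
import HarnessLib

/-!
# R90 · S6 — card H1 (row E1.3.5.2.5, coefficient layer): `ξ̂_H(φ_m)` IN THE `U(1,1)` HECKE BASIS —
# `ξ̂_H(φ_m) = (−q)^m φ′_m + (q² − 1) Σ_{k<m} (−q)^k q^{2(m−1−k)} φ′_k` (`Theorems/R90S6SatakeGraphPartnerOnBasis.lean`)

Cell `hodgecm-mathlib`, crux H413 (`stmt-HodgeConjecture-24833`), route of record `HCCMUnconditional`; programme R90-TF, section S6 (base `R90-C14`), seat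
R90-C14-p03 (g2); card H1 (dealer R90-C14-plan (g2), R90 bus 2026-09-05T00:31:44Z), DAG r5 row E1.3.5.2.5 «H-SIDE ENGINE … expand `ξ̂_H(φ_m) = Σ_k c_{m,k} φ′_k` in the
`U(2)` Hecke basis».  Helper lane `--supports stmt-HodgeConjecture-24833 --as helper`; theorems only (the STEP; the telescoped closed form with the explicit
coefficients `xiHCoeff` is the follow-up file `R90S6SatakeGraphPartnerOnBasisClosed`); imports = ★ heir W4 `R90S6SatakeGraphPartnerHom` + ★ p09 W8-g `R90S6MacdonaldRankOne` + ★ W8-g′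
`R90S6MacdonaldRankOneU2` + ★ `K2LiuRankOneHeckeCellsTwo` (`rev_vecOne`) + HarnessLib (Theorems import Theorems, never `Lines/`).

THE OBJECTS.  At an inert unramified place `w ∣ v` of the quadratic extension `E ∕ F` (`c ∈ Gal(E∕F)`, `c ≠ 1`, `c • w = w`): `ξ̂_H = satakeGraphPartnerAlgHom c hc1 v w hw hv :
ℋ(U(J₀,3)(E_w), K₀) →ₐ[ℂ] ℋ(U(J₀,2)(E_w), K₀)`, the algebra hom with GRAPH `λ^{(2)}_{(z,1)}(ξ̂_H φ) = λ^{(3)}_{(−z,1,1)}(φ)` for all `z ∈ ℂˣ` (★ `graph_satakeGraphPartnerAlgHom`;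
print's `ξ̂_H(f)^∧(z) = f^∧(−z)`, [Rogawski1990, §4.9 p. 55]); the Hecke bases `φ_m = 1_{K₀ t_wᵐ K₀}` (`t_w = hd_w.torusGen = diag(ϖ_w, 1, ϖ_w⁻¹)`, `hd_w` the datum ★
`unramifiedLocalConjDatum_localConjUniformizer`) and `φ′_k = 1_{K₀ t′ᵏ K₀}` (`t′ = diag(ϖ_w, ϖ_w⁻¹) ∈ U(J₀,2)(E_w)`, the element of ★ `UnitaryRankOneBasicHeckeOperator` ∕ W8-g′);
`Q = #𝓀[E_w] = q_v²`, `q = √Q = Nat.sqrt Q` (★ `sqrt_card_residueField_mul_self`).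

THE MATHEMATICS.  `λ^{(2)}_{(z,1)}(φ′₁) = q(z+z⁻¹) + q − 1` (★ `…_basic_two`), `λ^{(3)}_{(−z,1,1)}(φ₁) = −q²(z+z⁻¹) + q − 1` (★ `…_basic_three` at `Z = −z`), so
`ξ̂_H(φ₁) = −q φ′₁ + (q²−1)·1`.  In general **`ξ̂_H(φ_m) − q² ξ̂_H(φ_{m−1}) = (−1)^m (q^m φ′_m + q^{m−1} φ′_{m−1})`** (`m ≥ 1`): with `S = z + z⁻¹`, both
`D_m(z) := λ^{(3)}_{(−z,1,1)}(φ_m − q²φ_{m−1})` and `d_m(z) := (−1)^m (q^m λ^{(2)}_{(z,1)}(φ′_m) + q^{m−1} λ^{(2)}_{(z,1)}(φ′_{m−1}))` satisfy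
`X_{m+1} = −q²S·X_m − q⁴·X_{m−1}` for `m ≥ 3` (the N = 3 eigen recursion ★ p09 `heckeEigencharacter_doubleCosetOperator_torusGen_pow_succ` at `Z = −z`; and `u_k := (−q)^k λ^{(2)}(φ′_k)`
obeys the SAME recursion by the N = 2 one ★ W8-g′ `heckeEigencharacter_doubleCosetOperator_mul_pow_two_succ`, `d_m = u_m − u_{m−1}`) and agree at `m = 1, 2, 3` (the squares ★
`doubleCosetOperator_torusGen_mul_self` ∕ ★ `doubleCosetOperator_mul_self_two` supply `m = 2, 3`) — `heckeEigencharacter_partner_step` (§1, pure scalar bookkeeping `partner_step_scalar`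
§0); ★ `eq_satakeGraphPartner_of_graph` lifts it to `ℋ(U(1,1)_w)` (§2 `satakeGraphPartner_torusGen_pow_step`).  Telescoping: **`ξ̂_H(φ_m) = Σ_{k ≤ m} c_{m,k} φ′_k`**,
`c_{m,m} = (−q)^m`, `c_{m,k} = (q² − 1)(−q)^k q^{2(m−1−k)}` (`k < m`) — the follow-up file `R90S6SatakeGraphPartnerOnBasisClosed`.  With p01's A1 (orbital
integral = displacement count) and G1 this is the algebraic input of the H-side engine `SO^H(ξ̂_H φ_m) = Σ_k c_{m,k}·(displacement-k counts on the (q_v+1)-regular tree)`.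
HONEST LABEL: local spherical Hecke-algebra structure; proves no printed global statement, discharges no citation; count-neutral helper until E1.3.5.2.5∕.6 consume it.
HC_CM is proved only modulo the 7 printed citations (2 remaining named inputs: hLiu418 = stmt-HodgeConjecture-24832, h413 = stmt-HodgeConjecture-24833) until rung 0 closes; REL ≠ ★ ≠ BUILT.

## References
* [Rogawski1990] J. D. Rogawski, *Automorphic Representations of Unitary Groups in Three Variables*, Ann. of Math. Stud. 123 (1990), §4.9 Prop. 4.9.1 (b), Lemma 4.9.2 pp. 55–56; §4.5 p. 50.
* [CartierCorvallis1979] P. Cartier, *Representations of 𝔭-adic groups: a survey*, PSPM 33.1 (1979), §IV (4.2)–(4.4), Thm. 4.1, Cor. 4.2.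
* [Macdonald1971] I. G. Macdonald, *Spherical functions on a group of p-adic type*, Ramanujan Inst. Publ. 2 (1971), Ch. V §3.
-/

set_option autoImplicit false
-- the mandated namespace repeats the single-problem summit's segment (`HodgeConjecture.HodgeConjecture`)
set_option linter.dupNamespace false

noncomputable section

open scoped Valued WithZero Matrix MatrixGroups Pointwise
open MulAction ConjAct Polynomial

namespace Summit.HodgeConjecture.HodgeConjecture.R90.S6

open Literature.NumberTheory.Automorphic Literature.NumberTheory.Automorphic.HermitianLattice
  Literature.NumberTheory.Automorphic.HermitianLattice.UnramifiedLocalConjDatum Literature.NumberTheory.Automorphic.CartanUnique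
  Literature.NumberTheory.Automorphic.SymplecticCartan Literature.NumberTheory.Automorphic.heckeAlgebra

/-! ## §0 The scalar bookkeeping: two sequences with the U(3)∕U(2) eigenvalue recursions -/

/-- **Scalar step** (pure `ℂ`): if `ℓ` has the `U(1,1)` eigenvalue data (`ℓ₀ = 1`, `ℓ₁ = qS + q − 1`, `ℓ₁² = ℓ₂ + (q−1)ℓ₁ + (q²+q)`, `ℓ_{k+1} = qS ℓ_k − q² ℓ_{k−1}`,
`k ≥ 2`) and `L` the `U(3)` data at `−z` (`L₀ = 1`, `L₁ = −q²S + q − 1`, `L₁² = L₂ + (q−1)L₁ + (q⁴+q)`, `L_{m+1} = −q²S L_m − q⁴ L_{m−1}`, `m ≥ 2`), then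
`L_m − q² L_{m−1} = (−1)^m (q^m ℓ_m + q^{m−1} ℓ_{m−1})` for every `m ≥ 1` (both sides obey `X_{m+1} = −q²S X_m − q⁴ X_{m−1}` for `m ≥ 3`; `m = 1, 2, 3` by hand).
[cite: Macdonald1971, Ch. V §3] [cite: CartierCorvallis1979, §IV (4.2)–(4.4)] -/
theorem partner_step_scalar {q S : ℂ} {L ℓ : ℕ → ℂ}
    (hℓ0 : ℓ 0 = 1) (hℓ1 : ℓ 1 = q * S + (q - 1)) (hℓ2 : ℓ 1 * ℓ 1 = ℓ 2 + (q - 1) * ℓ 1 + (q * q + q))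
    (hℓ : ∀ k : ℕ, 2 ≤ k → ℓ (k + 1) = q * S * ℓ k - q * q * ℓ (k - 1))
    (hL0 : L 0 = 1) (hL1 : L 1 = q * q * (-S) + (q - 1)) (hL2 : L 1 * L 1 = L 2 + (q - 1) * L 1 + ((q * q) ^ 2 + q))
    (hL : ∀ m : ℕ, 2 ≤ m → L (m + 1) = q * q * (-S) * L m - (q * q) ^ 2 * L (m - 1))
    (m : ℕ) (hm : 1 ≤ m) :
    L m - q * q * L (m - 1) = (-1) ^ m * (q ^ m * ℓ m + q ^ (m - 1) * ℓ (m - 1)) := by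
  induction m using Nat.strong_induction_on with
  | _ m ih =>
    rcases m with _ | _ | _ | _ | n
    · omega
    · -- `m = 1`
      show L 1 - q * q * L 0 = (-1) ^ 1 * (q ^ 1 * ℓ 1 + q ^ 0 * ℓ 0)
      rw [hL1, hL0, hℓ1, hℓ0]; ring
    · -- `m = 2`
      show L 2 - q * q * L 1 = (-1) ^ 2 * (q ^ 2 * ℓ 2 + q ^ 1 * ℓ 1)
      have eL2 : L 2 = L 1 * L 1 - (q - 1) * L 1 - ((q * q) ^ 2 + q) := by linear_combination -hL2
      have eℓ2 : ℓ 2 = ℓ 1 * ℓ 1 - (q - 1) * ℓ 1 - (q * q + q) := by linear_combination -hℓ2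
      rw [eL2, eℓ2, hL1, hℓ1]; ring
    · -- `m = 3`
      show L 3 - q * q * L 2 = (-1) ^ 3 * (q ^ 3 * ℓ 3 + q ^ 2 * ℓ 2)
      have eL2 : L 2 = L 1 * L 1 - (q - 1) * L 1 - ((q * q) ^ 2 + q) := by linear_combination -hL2
      have eℓ2 : ℓ 2 = ℓ 1 * ℓ 1 - (q - 1) * ℓ 1 - (q * q + q) := by linear_combination -hℓ2
      have eL3 : L 3 = q * q * (-S) * L 2 - (q * q) ^ 2 * L 1 := hL 2 le_rfl
      have eℓ3 : ℓ 3 = q * S * ℓ 2 - q * q * ℓ 1 := hℓ 2 le_rfl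
      rw [eL3, eℓ3, eL2, eℓ2, hL1, hℓ1]; ring
    · -- `m = n + 4 ≥ 4`: the common recursion
      show L (n + 4) - q * q * L (n + 3) = (-1) ^ (n + 4) * (q ^ (n + 4) * ℓ (n + 4) + q ^ (n + 3) * ℓ (n + 3))
      have ih3 := ih (n + 3) (by omega) (by omega)
      have ih2 := ih (n + 2) (by omega) (by omega)
      rw [show n + 3 - 1 = n + 2 from rfl] at ih3
      rw [show n + 2 - 1 = n + 1 from rfl] at ih2
      have recL3 := hL (n + 3) (by omega)
      have recL2 := hL (n + 2) (by omega)
      have recℓ3 := hℓ (n + 3) (by omega)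
      have recℓ2 := hℓ (n + 2) (by omega)
      rw [show n + 3 - 1 = n + 2 from rfl] at recL3 recℓ3
      rw [show n + 2 - 1 = n + 1 from rfl] at recL2 recℓ2
      rw [show n + 3 + 1 = n + 4 from rfl] at recL3 recℓ3
      rw [show n + 2 + 1 = n + 3 from rfl] at recL2 recℓ2
      linear_combination recL3 - q * q * recL2 - q * q * S * ih3 - (q * q) ^ 2 * ih2 -
        (-1) ^ n * q ^ (n + 4) * recℓ3 - (-1) ^ n * q ^ (n + 3) * recℓ2

/-- Light-carrier bookkeeping: an algebra hom applied to a square formula `x * x = z + a • x + b • 1`. [folklore] -/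
private theorem algHom_mul_self_of_eq' {R A B : Type*} [CommSemiring R] [Semiring A] [Semiring B] [Algebra R A] [Algebra R B]
    (f : A →ₐ[R] B) {x z : A} {a b : R} (h : x * x = z + a • x + b • 1) : f x * f x = f z + a • f x + b • 1 := by
  rw [← map_mul, h, map_add, map_add, map_smul, map_smul, map_one]

/-! ## §1 The eigenvalue identity `λ₃_{(−z,1,1)}(φ_m − Q φ_{m−1}) = (−1)^m (q^m λ₂_{(z,1)}(φ′_m) + q^{m−1} λ₂_{(z,1)}(φ′_{m−1}))` (abstract datum) -/

section Abstract

variable {K : Type*} [Field K] [Valued K ℤᵐ⁰] {σ : K →+* K} {ϖ : K} [Finite 𝓀[K]]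
  [IsHeckeTriple (⊤ : Submonoid (unitaryGroupOfForm σ ((StdForm.antidiagonal 3).over K))) (unitaryInt σ ((StdForm.antidiagonal 3).over K))
    (unitaryInt σ ((StdForm.antidiagonal 3).over K))]
  [IsHeckeTriple (⊤ : Submonoid (unitaryGroupOfForm σ ((StdForm.antidiagonal 2).over K))) (unitaryInt σ ((StdForm.antidiagonal 2).over K))
    (unitaryInt σ ((StdForm.antidiagonal 2).over K))]

set_option maxHeartbeats 400000 in
/-- **THE PARTNER STEP ON EIGENVALUES** (abstract unramified datum `hd`, `σ ≠ id`, finite residue field): for every `z ∈ ℂˣ` and `m ≥ 1`,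
`λ^{(3)}_{(−z,1,1)}(φ_m) − Q·λ^{(3)}_{(−z,1,1)}(φ_{m−1}) = (−1)^m (q^m λ^{(2)}_{(z,1)}(φ′_m) + q^{m−1} λ^{(2)}_{(z,1)}(φ′_{m−1}))`, `φ_m = 1_{K₀ tᵐ K₀}` (`t = hd.torusGen`),
`φ′_k = 1_{K₀ t′ᵏ K₀}` (`t′ = diag(ϖ, ϖ⁻¹)`), `Q = #𝓀`, `q = √Q` — `partner_step_scalar` fed with ★ `…_basic_two∕three`, ★ `doubleCosetOperator_mul_self_two` ∕ ★
`doubleCosetOperator_torusGen_mul_self` and the two eigen recursions. [cite: Rogawski1990, §4.9 p. 55] [cite: CartierCorvallis1979, §IV (4.2)–(4.4)] -/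
theorem heckeEigencharacter_partner_step (hd : UnramifiedLocalConjDatum σ ϖ) (hσ : ∃ x : K, σ x ≠ x)
    (t : unitaryGroupOfForm σ ((StdForm.antidiagonal 2).over K)) (ht : (t : GL (Fin 2) K) = zpowDiagGL (uniformizer_ne_zero hd.vϖ) ![(1 : ℤ), -1])
    (z : ℂˣ) {m : ℕ} (hm : 1 ≤ m) :
    hd.heckeEigencharacter ![-z, 1, 1] (doubleCosetOperator (unitaryInt σ ((StdForm.antidiagonal 3).over K)) (hd.torusGen ^ m)) -
        ((Nat.card 𝓀[K] : ℕ) : ℂ) *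
          hd.heckeEigencharacter ![-z, 1, 1] (doubleCosetOperator (unitaryInt σ ((StdForm.antidiagonal 3).over K)) (hd.torusGen ^ (m - 1))) =
      (-1 : ℂ) ^ m *
        ((Nat.sqrt (Nat.card 𝓀[K]) : ℂ) ^ m *
            hd.heckeEigencharacter ![z, 1] (doubleCosetOperator (unitaryInt σ ((StdForm.antidiagonal 2).over K)) (t ^ m)) +
          (Nat.sqrt (Nat.card 𝓀[K]) : ℂ) ^ (m - 1) *
            hd.heckeEigencharacter ![z, 1] (doubleCosetOperator (unitaryInt σ ((StdForm.antidiagonal 2).over K)) (t ^ (m - 1)))) := by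
  -- `Q = q²`, `√Q − 1`, the torus parameters
  have hQ : ((Nat.card 𝓀[K] : ℕ) : ℂ) = (Nat.sqrt (Nat.card 𝓀[K]) : ℂ) * (Nat.sqrt (Nat.card 𝓀[K]) : ℂ) := by
    exact_mod_cast (hd.sqrt_card_residueField_mul_self hσ).symm
  have hq1 : (((Nat.sqrt (Nat.card 𝓀[K]) - 1 : ℕ) : ℂ)) = (Nat.sqrt (Nat.card 𝓀[K]) : ℂ) - 1 := by
    haveI : Nonempty 𝓀[K] := ⟨0⟩
    rw [Nat.cast_sub (Nat.succ_le_of_lt (Nat.sqrt_pos.2 Nat.card_pos)), Nat.cast_one]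
  have e20 : (![z, 1] : Fin 2 → ℂˣ) 0 = z := rfl
  have e21 : (![z, 1] : Fin 2 → ℂˣ) 1 = 1 := rfl
  have e30 : (![-z, 1, 1] : Fin 3 → ℂˣ) 0 = -z := rfl
  have e32 : (![-z, 1, 1] : Fin 3 → ℂˣ) 2 = 1 := rfl
  have hz2 : (((![z, 1] : Fin 2 → ℂˣ) 0 : ℂˣ) : ℂ) * ((((![z, 1] : Fin 2 → ℂˣ) 1 : ℂˣ) : ℂ))⁻¹ = (z : ℂ) := by
    rw [e20, e21, Units.val_one, inv_one, mul_one]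
  have hz3 : (((![-z, 1, 1] : Fin 3 → ℂˣ) 0 : ℂˣ) : ℂ) * ((((![-z, 1, 1] : Fin 3 → ℂˣ) 2 : ℂˣ) : ℂ))⁻¹ = -(z : ℂ) := by
    rw [e30, e32, Units.val_one, inv_one, mul_one, Units.val_neg]
  have hnegS : -(z : ℂ) + (-(z : ℂ))⁻¹ = -((z : ℂ) + (z : ℂ)⁻¹) := by rw [inv_neg]; ring
  -- the eight scalar inputs
  have hℓ0 : hd.heckeEigencharacter ![z, 1] (doubleCosetOperator (unitaryInt σ ((StdForm.antidiagonal 2).over K)) (t ^ 0)) = 1 := by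
    rw [pow_zero, doubleCosetOperator_one, map_one]
  have hℓ1 : hd.heckeEigencharacter ![z, 1] (doubleCosetOperator (unitaryInt σ ((StdForm.antidiagonal 2).over K)) (t ^ 1)) =
      (Nat.sqrt (Nat.card 𝓀[K]) : ℂ) * ((z : ℂ) + (z : ℂ)⁻¹) + ((Nat.sqrt (Nat.card 𝓀[K]) : ℂ) - 1) := by
    rw [pow_one, eq_basic_two hd t ht, hd.heckeEigencharacter_doubleCosetOperator_basic_two hσ, hz2]
  have hℓ2 : hd.heckeEigencharacter ![z, 1] (doubleCosetOperator (unitaryInt σ ((StdForm.antidiagonal 2).over K)) (t ^ 1)) *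
        hd.heckeEigencharacter ![z, 1] (doubleCosetOperator (unitaryInt σ ((StdForm.antidiagonal 2).over K)) (t ^ 1)) =
      hd.heckeEigencharacter ![z, 1] (doubleCosetOperator (unitaryInt σ ((StdForm.antidiagonal 2).over K)) (t ^ 2)) +
        ((Nat.sqrt (Nat.card 𝓀[K]) : ℂ) - 1) * hd.heckeEigencharacter ![z, 1] (doubleCosetOperator (unitaryInt σ ((StdForm.antidiagonal 2).over K)) (t ^ 1)) +
        ((Nat.sqrt (Nat.card 𝓀[K]) : ℂ) * (Nat.sqrt (Nat.card 𝓀[K]) : ℂ) + (Nat.sqrt (Nat.card 𝓀[K]) : ℂ)) := by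
    have h := algHom_mul_self_of_eq' (hd.heckeEigencharacter ![z, 1]) (doubleCosetOperator_mul_self_two (k := ℂ) hd hσ t ht)
    simp only [smul_eq_mul, mul_one, Nat.cast_add] at h
    rw [hq1, hQ] at h
    rw [pow_one]
    exact h
  have hℓ : ∀ k : ℕ, 2 ≤ k →
      hd.heckeEigencharacter ![z, 1] (doubleCosetOperator (unitaryInt σ ((StdForm.antidiagonal 2).over K)) (t ^ (k + 1))) =
        (Nat.sqrt (Nat.card 𝓀[K]) : ℂ) * ((z : ℂ) + (z : ℂ)⁻¹) *
            hd.heckeEigencharacter ![z, 1] (doubleCosetOperator (unitaryInt σ ((StdForm.antidiagonal 2).over K)) (t ^ k)) -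
          (Nat.sqrt (Nat.card 𝓀[K]) : ℂ) * (Nat.sqrt (Nat.card 𝓀[K]) : ℂ) *
            hd.heckeEigencharacter ![z, 1] (doubleCosetOperator (unitaryInt σ ((StdForm.antidiagonal 2).over K)) (t ^ (k - 1))) := by
    intro k hk
    rw [heckeEigencharacter_doubleCosetOperator_mul_pow_two_succ hd hσ t ht ![z, 1] hk, hz2, hQ]
  have hL0 : hd.heckeEigencharacter ![-z, 1, 1] (doubleCosetOperator (unitaryInt σ ((StdForm.antidiagonal 3).over K)) (hd.torusGen ^ 0)) = 1 := by
    rw [pow_zero, doubleCosetOperator_one, map_one]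
  have hL1 : hd.heckeEigencharacter ![-z, 1, 1] (doubleCosetOperator (unitaryInt σ ((StdForm.antidiagonal 3).over K)) (hd.torusGen ^ 1)) =
      (Nat.sqrt (Nat.card 𝓀[K]) : ℂ) * (Nat.sqrt (Nat.card 𝓀[K]) : ℂ) * (-((z : ℂ) + (z : ℂ)⁻¹)) + ((Nat.sqrt (Nat.card 𝓀[K]) : ℂ) - 1) := by
    rw [pow_one, torusGen_eq_basic hd, hd.heckeEigencharacter_doubleCosetOperator_basic_three hσ, hz3, hnegS, ← hQ]
  have hL2 : hd.heckeEigencharacter ![-z, 1, 1] (doubleCosetOperator (unitaryInt σ ((StdForm.antidiagonal 3).over K)) (hd.torusGen ^ 1)) *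
        hd.heckeEigencharacter ![-z, 1, 1] (doubleCosetOperator (unitaryInt σ ((StdForm.antidiagonal 3).over K)) (hd.torusGen ^ 1)) =
      hd.heckeEigencharacter ![-z, 1, 1] (doubleCosetOperator (unitaryInt σ ((StdForm.antidiagonal 3).over K)) (hd.torusGen ^ 2)) +
        ((Nat.sqrt (Nat.card 𝓀[K]) : ℂ) - 1) *
          hd.heckeEigencharacter ![-z, 1, 1] (doubleCosetOperator (unitaryInt σ ((StdForm.antidiagonal 3).over K)) (hd.torusGen ^ 1)) +
        (((Nat.sqrt (Nat.card 𝓀[K]) : ℂ) * (Nat.sqrt (Nat.card 𝓀[K]) : ℂ)) ^ 2 + (Nat.sqrt (Nat.card 𝓀[K]) : ℂ)) := by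
    have h := algHom_mul_self_of_eq' (hd.heckeEigencharacter ![-z, 1, 1]) (doubleCosetOperator_torusGen_mul_self (k := ℂ) hd hσ)
    simp only [smul_eq_mul, mul_one, Nat.cast_add, Nat.cast_pow] at h
    rw [hq1, hQ] at h
    rw [pow_one]
    exact h
  have hL : ∀ m : ℕ, 2 ≤ m →
      hd.heckeEigencharacter ![-z, 1, 1] (doubleCosetOperator (unitaryInt σ ((StdForm.antidiagonal 3).over K)) (hd.torusGen ^ (m + 1))) =
        (Nat.sqrt (Nat.card 𝓀[K]) : ℂ) * (Nat.sqrt (Nat.card 𝓀[K]) : ℂ) * (-((z : ℂ) + (z : ℂ)⁻¹)) *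
            hd.heckeEigencharacter ![-z, 1, 1] (doubleCosetOperator (unitaryInt σ ((StdForm.antidiagonal 3).over K)) (hd.torusGen ^ m)) -
          ((Nat.sqrt (Nat.card 𝓀[K]) : ℂ) * (Nat.sqrt (Nat.card 𝓀[K]) : ℂ)) ^ 2 *
            hd.heckeEigencharacter ![-z, 1, 1] (doubleCosetOperator (unitaryInt σ ((StdForm.antidiagonal 3).over K)) (hd.torusGen ^ (m - 1))) := by
    intro m hm'
    rw [heckeEigencharacter_doubleCosetOperator_torusGen_pow_succ hd hσ ![-z, 1, 1] hm', hz3, hnegS]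
    simp only [Nat.cast_pow]
    rw [hQ]
  rw [hQ]
  exact partner_step_scalar (q := (Nat.sqrt (Nat.card 𝓀[K]) : ℂ)) (S := (z : ℂ) + (z : ℂ)⁻¹)
    (L := fun m => hd.heckeEigencharacter ![-z, 1, 1] (doubleCosetOperator (unitaryInt σ ((StdForm.antidiagonal 3).over K)) (hd.torusGen ^ m)))
    (ℓ := fun k => hd.heckeEigencharacter ![z, 1] (doubleCosetOperator (unitaryInt σ ((StdForm.antidiagonal 2).over K)) (t ^ k)))
    hℓ0 hℓ1 hℓ2 hℓ hL0 hL1 hL2 hL m hm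

/-- The same identity in the `•`-shape produced by `map_add ∕ map_smul ∕ map_sub` on the two eigencharacters (for the adic lift). [cite: Rogawski1990, §4.9 p. 55] -/
theorem heckeEigencharacter_partner_step_smul (hd : UnramifiedLocalConjDatum σ ϖ) (hσ : ∃ x : K, σ x ≠ x)
    (t : unitaryGroupOfForm σ ((StdForm.antidiagonal 2).over K)) (ht : (t : GL (Fin 2) K) = zpowDiagGL (uniformizer_ne_zero hd.vϖ) ![(1 : ℤ), -1])
    (z : ℂˣ) {m : ℕ} (hm : 1 ≤ m) :
    ((-1 : ℂ) ^ m * (Nat.sqrt (Nat.card 𝓀[K]) : ℂ) ^ m) •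
          hd.heckeEigencharacter ![z, 1] (doubleCosetOperator (unitaryInt σ ((StdForm.antidiagonal 2).over K)) (t ^ m)) +
        ((-1 : ℂ) ^ m * (Nat.sqrt (Nat.card 𝓀[K]) : ℂ) ^ (m - 1)) •
          hd.heckeEigencharacter ![z, 1] (doubleCosetOperator (unitaryInt σ ((StdForm.antidiagonal 2).over K)) (t ^ (m - 1))) =
      hd.heckeEigencharacter ![-z, 1, 1] (doubleCosetOperator (unitaryInt σ ((StdForm.antidiagonal 3).over K)) (hd.torusGen ^ m)) -
        ((Nat.card 𝓀[K] : ℕ) : ℂ) •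
          hd.heckeEigencharacter ![-z, 1, 1] (doubleCosetOperator (unitaryInt σ ((StdForm.antidiagonal 3).over K)) (hd.torusGen ^ (m - 1))) := by
  have key := heckeEigencharacter_partner_step hd hσ t ht z hm
  simp only [smul_eq_mul]
  linear_combination -key

end Abstract

/-! ## §2 The partner step in `ℋ(U(1,1)_w)` at an inert unramified place -/

section Adic

open NumberField IsDedekindDomain Literature.NumberTheory.Automorphic.UnitaryGroup
-- `rev_vecOne : (1, −1) ∘ rev = −(1, −1)` (★ `K2LiuRankOneHeckeCellsTwo`) puts `t′ = diag(ϖ_w, ϖ_w⁻¹)` in `U(J₀,2)(E_w)` via ★ `zpowDiagGL_mem_unitaryGroupOfForm`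
open Summit.HodgeConjecture.HodgeConjecture.Cruxes.HLiu418.K2LiuRankOneHeckeCellsTwo (rev_vecOne)

variable {F E : Type} [Field F] [NumberField F] [Field E] [NumberField E] [Algebra F E] [Algebra.IsQuadraticExtension F E]
  (c : E ≃ₐ[F] E) (hc1 : c ≠ 1) (v : HeightOneSpectrum (𝓞 F)) (w : PlacesOver E v) (hw : c • w.1 = w.1)
  (hv : Algebra.IsUnramifiedIn (𝓞 E) v.asIdeal)

-- (as in ★ `R90S6SatakeGraphPartner`: the `heckeAlgebra` carrier at `E_w` meets the generic algebra-hom lemmas only through a costly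
--  instance-path unification — no search explosion, no `decide`; hence the raised heartbeat budgets)
set_option synthInstance.maxHeartbeats 400000 in
set_option maxHeartbeats 1600000 in
/-- **THE PARTNER STEP `ξ̂_H(φ_m) − Q·ξ̂_H(φ_{m−1}) = (−1)^m (q^m φ′_m + q^{m−1} φ′_{m−1})` IN `ℋ(U(J₀,2)(E_w), K₀)`** at an inert unramified place `w ∣ v`
(`m ≥ 1`; `φ_m = 1_{K₀ t_wᵐ K₀}`, `t_w = hd_w.torusGen`, `hd_w = unramifiedLocalConjDatum_localConjUniformizer …`; `φ′_k = 1_{K₀ t′ᵏ K₀}`, `t′ = diag(ϖ_w, ϖ_w⁻¹)`;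
`Q = #𝓀[E_w] = q_v²`, `q = Nat.sqrt Q = q_v`): the element on the right is in Satake-graph position with `φ_m − Q φ_{m−1}` (§1 at every `z`, ★
`unitaryHeckeEigencharacterAdic_eq`), hence IS its partner (★ `eq_satakeGraphPartner_of_graph`), and `ξ̂_H` is linear. [cite: Rogawski1990, §4.9 Prop. 4.9.1 (b), p. 55]
[cite: CartierCorvallis1979, §IV (4.2)–(4.4), Cor. 4.2] -/
theorem satakeGraphPartner_torusGen_pow_step {m : ℕ} (hm : 1 ≤ m) :
    haveI := isHeckeTriple_unitaryInt_adicCompletion c v w hw ((StdForm.antidiagonal 3).over (w.1.adicCompletion E))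
    haveI := isHeckeTriple_unitaryInt_adicCompletion c v w hw ((StdForm.antidiagonal 2).over (w.1.adicCompletion E))
    satakeGraphPartnerAlgHom c hc1 v w hw hv
        (doubleCosetOperator (unitaryInt (galAdicCompletionMap (L := E) c hw) ((StdForm.antidiagonal 3).over (w.1.adicCompletion E)))
          ((unramifiedLocalConjDatum_localConjUniformizer c hc1 v w hw hv).torusGen ^ m)) -
      ((Nat.card 𝓀[w.1.adicCompletion E] : ℕ) : ℂ) •
        satakeGraphPartnerAlgHom c hc1 v w hw hv
          (doubleCosetOperator (unitaryInt (galAdicCompletionMap (L := E) c hw) ((StdForm.antidiagonal 3).over (w.1.adicCompletion E)))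
            ((unramifiedLocalConjDatum_localConjUniformizer c hc1 v w hw hv).torusGen ^ (m - 1))) =
      ((-1 : ℂ) ^ m * (Nat.sqrt (Nat.card 𝓀[w.1.adicCompletion E]) : ℂ) ^ m) •
          doubleCosetOperator (unitaryInt (galAdicCompletionMap (L := E) c hw) ((StdForm.antidiagonal 2).over (w.1.adicCompletion E)))
            ((⟨zpowDiagGL (uniformizer_ne_zero (unramifiedLocalConjDatum_localConjUniformizer c hc1 v w hw hv).vϖ) ![(1 : ℤ), -1],
              zpowDiagGL_mem_unitaryGroupOfForm (unramifiedLocalConjDatum_localConjUniformizer c hc1 v w hw hv).σϖ _ rev_vecOne⟩ :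
              ↥(unitaryGroupOfForm (galAdicCompletionMap (L := E) c hw) ((StdForm.antidiagonal 2).over (w.1.adicCompletion E)))) ^ m) +
        ((-1 : ℂ) ^ m * (Nat.sqrt (Nat.card 𝓀[w.1.adicCompletion E]) : ℂ) ^ (m - 1)) •
          doubleCosetOperator (unitaryInt (galAdicCompletionMap (L := E) c hw) ((StdForm.antidiagonal 2).over (w.1.adicCompletion E)))
            ((⟨zpowDiagGL (uniformizer_ne_zero (unramifiedLocalConjDatum_localConjUniformizer c hc1 v w hw hv).vϖ) ![(1 : ℤ), -1],
              zpowDiagGL_mem_unitaryGroupOfForm (unramifiedLocalConjDatum_localConjUniformizer c hc1 v w hw hv).σϖ _ rev_vecOne⟩ :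
              ↥(unitaryGroupOfForm (galAdicCompletionMap (L := E) c hw) ((StdForm.antidiagonal 2).over (w.1.adicCompletion E)))) ^ (m - 1)) := by
  haveI := Literature.NumberTheory.Automorphic.finite_residueField_adicCompletion E w.1
  haveI := isHeckeTriple_unitaryInt_adicCompletion c v w hw ((StdForm.antidiagonal 3).over (w.1.adicCompletion E))
  haveI := isHeckeTriple_unitaryInt_adicCompletion c v w hw ((StdForm.antidiagonal 2).over (w.1.adicCompletion E))
  have hσ : ∃ x : w.1.adicCompletion E, galAdicCompletionMap (L := E) c hw x ≠ x := exists_galAdicCompletionMap_ne c hc1 v w hw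
  -- `ξ̂_H(φ_m) − Q ξ̂_H(φ_{m−1}) = ξ̂_H(φ_m − Q φ_{m−1})`, and the right-hand side IS the partner of `φ_m − Q φ_{m−1}`
  rw [← map_smul (satakeGraphPartnerAlgHom c hc1 v w hw hv), ← map_sub (satakeGraphPartnerAlgHom c hc1 v w hw hv),
    satakeGraphPartnerAlgHom_apply]
  symm
  refine eq_satakeGraphPartner_of_graph c hc1 v w hw hv _ _ (fun z => ?_)
  -- the scalar identity of §1 at the datum of record (`λ^{adic}_β` IS `hd_w.heckeEigencharacter β` by definition)
  rw [map_add (unitaryHeckeEigencharacterAdic c hc1 v w hw hv ![z, 1]), map_smul (unitaryHeckeEigencharacterAdic c hc1 v w hw hv ![z, 1]),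
    map_smul (unitaryHeckeEigencharacterAdic c hc1 v w hw hv ![z, 1]), map_sub (unitaryHeckeEigencharacterAdic c hc1 v w hw hv ![-z, 1, 1]),
    map_smul (unitaryHeckeEigencharacterAdic c hc1 v w hw hv ![-z, 1, 1])]
  exact heckeEigencharacter_partner_step_smul (unramifiedLocalConjDatum_localConjUniformizer c hc1 v w hw hv) hσ
    (⟨zpowDiagGL (uniformizer_ne_zero (unramifiedLocalConjDatum_localConjUniformizer c hc1 v w hw hv).vϖ) ![(1 : ℤ), -1],
      zpowDiagGL_mem_unitaryGroupOfForm (unramifiedLocalConjDatum_localConjUniformizer c hc1 v w hw hv).σϖ _ rev_vecOne⟩ :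
      ↥(unitaryGroupOfForm (galAdicCompletionMap (L := E) c hw) ((StdForm.antidiagonal 2).over (w.1.adicCompletion E)))) rfl z hm

end Adic

end Summit.HodgeConjecture.HodgeConjecture.R90.S6

end
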